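import Summits.Schanuel.Schanuel.Theorems.RootDecomp1KPiScale02

/-!
# RootDecomp1KPiScale — lens 6, generation 20 «NESTERENKO-MEASURED SCALE π» (frame G20: lane T = the hypothesis-free DISCHARGE of the strong measure (31) at ω̄(e^{−2π}) from the tree-proved Nesterenko Ch. 3 Thm 5.1 / Prop 4.11 / Prop 4.8 ⇒ `LogPowMeasure ![π, e^π]`; lane F = K-R27 (F₊) cells on the π-lines for every log-hyper-Liouville ratio) — continuation (RootDecomp1KPiScale03): §6 the π-line CELLS for every log-hyper-Liouville ratio (lane F) + §6a member + §6b the tree π-cells with h52 removed + §7 the residual-shrink certificate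

(lens-6 g20 `PiScale.lean` [HOME/decomp-schanuel-lens-6/g20/ sha256 87044252…, 707 l; NODE L1983 / REQUEST L1984; critic VERDICT L1986 (THEOREM ×1 + K-R27 (F₊) CELL ×1, port GO)]; port by census-1 gen 17 as
`RootDecomp1KPiScale01`–`03` — see the PORT NOTE of part 01; `--supports stmt-Schanuel-33364`; rung 0.)
-/

noncomputable section

open Complex IntermediateField
open MvPolynomial (aeval rename X C)
open Literature.NumberTheory.Transcendental
open Literature.NumberTheory.Transcendental.Nesterenko
open Literature.Barriers.Schanuel
open Summit.Schanuel.Schanuel.Theorems.RootDecomp1KHyper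
open Summit.Schanuel.Schanuel.Theorems.RootDecomp1KHyper.HyperCell
open Summit.Schanuel.Schanuel.Theorems.RootDecomp1KGeneric
open Summit.Schanuel.Schanuel.Theorems.RootDecomp1KRelLiouvilleCell
open Summit.Schanuel.Schanuel.Theorems.RootDecomp1KDarkLogSq
open Summit.Schanuel.Schanuel.Theorems.RootDecomp1KHyper.HyperCell.LatCell.Bilog (mvlen_rename)

namespace Summit.Schanuel.Schanuel.Theorems.RootDecomp1KPiScale

/-! ## §6  Cells: Schanuel's bound on Schanuel fields containing `π`, `e^π` and a log-hyper-Liouville real -/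

/-- `θ₂ = ((e^π)^{-2}, 3/π)` lies in every subfield containing `π` and `e^π`. -/
theorem theta2_mem {F : IntermediateField ℚ ℂ} (hπ : (Real.pi : ℂ) ∈ F) (he : cexp (Real.pi : ℂ) ∈ F) :
    ∀ j, θ2 j ∈ F := by
  intro j
  fin_cases j
  · show qπ ∈ F
    rw [qπ_eq_zpow]; exact zpow_mem he _
  · show ramanujanP qπ ∈ F
    rw [ramanujanP_qπ]; exact div_mem (ofNat_mem F 3) hπ

/-- `θ₃ = ((e^π)^{-2}, 3/π, 3Γ(1/4)⁸/(2π)⁶)` lies in every subfield containing `π`, `e^π`, `Γ(1/4)`. -/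
theorem theta3_mem {F : IntermediateField ℚ ℂ} (hπ : (Real.pi : ℂ) ∈ F) (he : cexp (Real.pi : ℂ) ∈ F)
    (hΓ : (Real.Gamma (1 / 4) : ℂ) ∈ F) : ∀ j, θ3 j ∈ F := by
  intro j
  fin_cases j
  · show qπ ∈ F
    rw [qπ_eq_zpow]; exact zpow_mem he _
  · show ramanujanP qπ ∈ F
    rw [ramanujanP_qπ]; exact div_mem (ofNat_mem F 3) hπ
  · show ramanujanQ qπ ∈ F
    rw [ramanujanQ_qπ]
    exact div_mem (mul_mem (ofNat_mem F 3) (pow_mem hΓ 8)) (pow_mem (mul_mem (ofNat_mem F 2) hπ) 6)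

/-- **GENERAL CELL, level 3 (hypothesis-free).** `SB 3 z` for every `z : Fin 3 → ℂ` whose Schanuel field
`ℚ(z, e^z, i)` contains `π`, `e^π` and a real log-hyper-Liouville `ρ` (then `ρ, e^{-2π}, 3/π` are algebraically
independent in that field, by the TREE principle `sb_of_logHyperLiouville_of_logPowMeasure`). -/
theorem sb_three_of_pi_expPi_mem {z : Fin 3 → ℂ} {ρ : ℝ} (hρ : LogHyperLiouville ρ)
    (hρz : (ρ : ℂ) ∈ adjoin ℚ (SFset z ∪ {I})) (hπ : (Real.pi : ℂ) ∈ adjoin ℚ (SFset z ∪ {I}))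
    (he : cexp (Real.pi : ℂ) ∈ adjoin ℚ (SFset z ∪ {I})) : SB 3 z :=
  sb_of_logHyperLiouville_of_logPowMeasure (n := 2) hρ hρz logPowMeasure_theta2 (theta2_mem hπ he)

/-- **GENERAL CELL, level 4 (hypothesis-free).** `SB 4 z` for every `z : Fin 4 → ℂ` whose Schanuel field contains
`π`, `e^π`, `Γ(1/4)` and a real log-hyper-Liouville `ρ`. -/
theorem sb_four_of_pi_expPi_gamma_mem {z : Fin 4 → ℂ} {ρ : ℝ} (hρ : LogHyperLiouville ρ)
    (hρz : (ρ : ℂ) ∈ adjoin ℚ (SFset z ∪ {I})) (hπ : (Real.pi : ℂ) ∈ adjoin ℚ (SFset z ∪ {I}))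
    (he : cexp (Real.pi : ℂ) ∈ adjoin ℚ (SFset z ∪ {I}))
    (hΓ : (Real.Gamma (1 / 4) : ℂ) ∈ adjoin ℚ (SFset z ∪ {I})) : SB 4 z :=
  sb_of_logHyperLiouville_of_logPowMeasure (n := 3) hρ hρz logPowMeasure_theta3 (theta3_mem hπ he hΓ)

/-- **THE CELL PREDICATE (level 3).**  `PiScaleClass z`: the Schanuel field `ℚ(z, e^z, i)` of the triple `z`
contains `π`, `e^{π}` and a real LOG-HYPER-LIOUVILLE number `ρ` (tree `RootDecomp1KRelLiouvilleCell.LogHyperLiouville`: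
for every `m`, a rational `a/b`, `b ≥ m`, with `|ρ − a/b| < exp(−(log b)^m)`).  Cell definition in the binder currency
of items 33364 / 33363: the class is a condition on the FIELD of `z`, not on its approximation data; on the lines
`(π/k, ρ·π/k, w)` it reads «ratio `ρ` log-hyper-Liouville». -/
def PiScaleClass (z : Fin 3 → ℂ) : Prop :=
  (Real.pi : ℂ) ∈ adjoin ℚ (SFset z ∪ {I}) ∧ cexp (Real.pi : ℂ) ∈ adjoin ℚ (SFset z ∪ {I}) ∧
    ∃ ρ : ℝ, LogHyperLiouville ρ ∧ (ρ : ℂ) ∈ adjoin ℚ (SFset z ∪ {I})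

/-- **THE CELL (hypothesis-free).**  Schanuel's bound `trdeg ℚ(z, e^z) ≥ 3` on `PiScaleClass`. -/
theorem sb_three_of_piScaleClass {z : Fin 3 → ℂ} (h : PiScaleClass z) : SB 3 z := by
  obtain ⟨hπ, he, ρ, hρ, hρz⟩ := h
  exact sb_three_of_pi_expPi_mem hρ hρz hπ he

/-- Field bookkeeping at the scale `u = π/k`, `k ∈ ℤ ∖ 0`: `π = k·u` and `e^π = (e^u)^k`. -/
theorem pi_expPi_mem_of_scale {F : IntermediateField ℚ ℂ} {k : ℤ} (hk : k ≠ 0)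
    (hu : (Real.pi : ℂ) / k ∈ F) (heu : cexp ((Real.pi : ℂ) / k) ∈ F) :
    (Real.pi : ℂ) ∈ F ∧ cexp (Real.pi : ℂ) ∈ F := by
  have hk' : (k : ℂ) ≠ 0 := Int.cast_ne_zero.mpr hk
  have hπk : (Real.pi : ℂ) = (k : ℂ) * ((Real.pi : ℂ) / k) := by field_simp
  refine ⟨?_, ?_⟩
  · rw [hπk]; exact mul_mem (intCast_mem F k) hu
  · rw [hπk, Complex.exp_int_mul]; exact zpow_mem heu k

/-- **LINE CELL at the scale `π/k` (hypothesis-free).** `SB 3 (π/k, ρ·π/k, w)` for EVERY `w ∈ ℂ`, every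
`k ∈ ℤ ∖ 0` and every real log-hyper-Liouville `ρ`.  (Tree: `hyperCell_pi_any` needs `HyperLiouville ρ` and the
registered Cor. 5.2; `RootDecomp1KGeneric.ordCell_any` needs `LiouvilleOrder 49 ρ` and NW96 Thm 1.) -/
theorem sb_three_piLine {k : ℤ} (hk : k ≠ 0) {ρ : ℝ} (hρ : LogHyperLiouville ρ) (w : ℂ) :
    SB 3 ![(Real.pi : ℂ) / k, (ρ : ℂ) * ((Real.pi : ℂ) / k), w] := by
  have hk' : (k : ℂ) ≠ 0 := Int.cast_ne_zero.mpr hk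
  have hπ0 : (Real.pi : ℂ) ≠ 0 := ofReal_ne_zero.mpr Real.pi_ne_zero
  have hu0 : (Real.pi : ℂ) / k ≠ 0 := div_ne_zero hπ0 hk'
  have hz0 : (Real.pi : ℂ) / k ∈
      adjoin ℚ (SFset ![(Real.pi : ℂ) / k, (ρ : ℂ) * ((Real.pi : ℂ) / k), w] ∪ {I}) :=
    mem_adjoin_SFset_I' (Or.inl ⟨0, rfl⟩)
  have hz1 : (ρ : ℂ) * ((Real.pi : ℂ) / k) ∈
      adjoin ℚ (SFset ![(Real.pi : ℂ) / k, (ρ : ℂ) * ((Real.pi : ℂ) / k), w] ∪ {I}) :=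
    mem_adjoin_SFset_I' (Or.inl ⟨1, rfl⟩)
  have he0 : cexp ((Real.pi : ℂ) / k) ∈
      adjoin ℚ (SFset ![(Real.pi : ℂ) / k, (ρ : ℂ) * ((Real.pi : ℂ) / k), w] ∪ {I}) :=
    mem_adjoin_SFset_I' (Or.inr ⟨0, rfl⟩)
  have hρmem : (ρ : ℂ) ∈ adjoin ℚ (SFset ![(Real.pi : ℂ) / k, (ρ : ℂ) * ((Real.pi : ℂ) / k), w] ∪ {I}) := by
    have hdiv := div_mem hz1 hz0
    rwa [mul_div_assoc, div_self hu0, mul_one] at hdiv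
  obtain ⟨hπ, he⟩ := pi_expPi_mem_of_scale hk hz0 he0
  exact sb_three_of_pi_expPi_mem hρ hρmem hπ he

/-- **LINE CELL with `Γ(1/4)`, level 4 (hypothesis-free).** `SB 4 (π/k, ρ·π/k, Γ(1/4), w)` for every `w`,
every `k ∈ ℤ ∖ 0`, every real log-hyper-Liouville `ρ` (tree `hyperCell_pi_gamma_any`: hyper ρ mod Cor. 5.2). -/
theorem sb_four_piGammaLine {k : ℤ} (hk : k ≠ 0) {ρ : ℝ} (hρ : LogHyperLiouville ρ) (w : ℂ) :
    SB 4 ![(Real.pi : ℂ) / k, (ρ : ℂ) * ((Real.pi : ℂ) / k), (Real.Gamma (1 / 4) : ℂ), w] := by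
  have hk' : (k : ℂ) ≠ 0 := Int.cast_ne_zero.mpr hk
  have hπ0 : (Real.pi : ℂ) ≠ 0 := ofReal_ne_zero.mpr Real.pi_ne_zero
  have hu0 : (Real.pi : ℂ) / k ≠ 0 := div_ne_zero hπ0 hk'
  have hz0 : (Real.pi : ℂ) / k ∈ adjoin ℚ
      (SFset ![(Real.pi : ℂ) / k, (ρ : ℂ) * ((Real.pi : ℂ) / k), (Real.Gamma (1 / 4) : ℂ), w] ∪ {I}) :=
    mem_adjoin_SFset_I' (Or.inl ⟨0, rfl⟩)
  have hz1 : (ρ : ℂ) * ((Real.pi : ℂ) / k) ∈ adjoin ℚ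
      (SFset ![(Real.pi : ℂ) / k, (ρ : ℂ) * ((Real.pi : ℂ) / k), (Real.Gamma (1 / 4) : ℂ), w] ∪ {I}) :=
    mem_adjoin_SFset_I' (Or.inl ⟨1, rfl⟩)
  have hz2 : (Real.Gamma (1 / 4) : ℂ) ∈ adjoin ℚ
      (SFset ![(Real.pi : ℂ) / k, (ρ : ℂ) * ((Real.pi : ℂ) / k), (Real.Gamma (1 / 4) : ℂ), w] ∪ {I}) :=
    mem_adjoin_SFset_I' (Or.inl ⟨2, rfl⟩)
  have he0 : cexp ((Real.pi : ℂ) / k) ∈ adjoin ℚ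
      (SFset ![(Real.pi : ℂ) / k, (ρ : ℂ) * ((Real.pi : ℂ) / k), (Real.Gamma (1 / 4) : ℂ), w] ∪ {I}) :=
    mem_adjoin_SFset_I' (Or.inr ⟨0, rfl⟩)
  have hρmem : (ρ : ℂ) ∈ adjoin ℚ
      (SFset ![(Real.pi : ℂ) / k, (ρ : ℂ) * ((Real.pi : ℂ) / k), (Real.Gamma (1 / 4) : ℂ), w] ∪ {I}) := by
    have hdiv := div_mem hz1 hz0
    rwa [mul_div_assoc, div_self hu0, mul_one] at hdiv
  obtain ⟨hπ, he⟩ := pi_expPi_mem_of_scale hk hz0 he0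
  exact sb_four_of_pi_expPi_gamma_mem hρ hρmem hπ he hz2

/-- The scale `π` itself (`k = 1`): `SB 3 (π, ρπ, w)` for every log-hyper-Liouville `ρ` and every `w`. -/
theorem sb_three_piLine_one {ρ : ℝ} (hρ : LogHyperLiouville ρ) (w : ℂ) :
    SB 3 ![(Real.pi : ℂ), (ρ : ℂ) * Real.pi, w] := by
  have h := sb_three_piLine (k := 1) one_ne_zero hρ w
  simpa using h

/-- Membership of the line `(π/k, ρ·π/k, w)` in `PiScaleClass`. -/
theorem piScaleClass_piLine {k : ℤ} (hk : k ≠ 0) {ρ : ℝ} (hρ : LogHyperLiouville ρ) (w : ℂ) :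
    PiScaleClass ![(Real.pi : ℂ) / k, (ρ : ℂ) * ((Real.pi : ℂ) / k), w] := by
  have hk' : (k : ℂ) ≠ 0 := Int.cast_ne_zero.mpr hk
  have hπ0 : (Real.pi : ℂ) ≠ 0 := ofReal_ne_zero.mpr Real.pi_ne_zero
  have hu0 : (Real.pi : ℂ) / k ≠ 0 := div_ne_zero hπ0 hk'
  have hz0 : (Real.pi : ℂ) / k ∈
      adjoin ℚ (SFset ![(Real.pi : ℂ) / k, (ρ : ℂ) * ((Real.pi : ℂ) / k), w] ∪ {I}) :=
    mem_adjoin_SFset_I' (Or.inl ⟨0, rfl⟩)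
  have hz1 : (ρ : ℂ) * ((Real.pi : ℂ) / k) ∈
      adjoin ℚ (SFset ![(Real.pi : ℂ) / k, (ρ : ℂ) * ((Real.pi : ℂ) / k), w] ∪ {I}) :=
    mem_adjoin_SFset_I' (Or.inl ⟨1, rfl⟩)
  have he0 : cexp ((Real.pi : ℂ) / k) ∈
      adjoin ℚ (SFset ![(Real.pi : ℂ) / k, (ρ : ℂ) * ((Real.pi : ℂ) / k), w] ∪ {I}) :=
    mem_adjoin_SFset_I' (Or.inr ⟨0, rfl⟩)
  have hρmem : (ρ : ℂ) ∈ adjoin ℚ (SFset ![(Real.pi : ℂ) / k, (ρ : ℂ) * ((Real.pi : ℂ) / k), w] ∪ {I}) := by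
    have hdiv := div_mem hz1 hz0
    rwa [mul_div_assoc, div_self hu0, mul_one] at hdiv
  obtain ⟨hπ, he⟩ := pi_expPi_mem_of_scale hk hz0 he0
  exact ⟨hπ, he, ρ, hρ, hρmem⟩

/-- **COORDINATE SHAPE (hypothesis-free).** `SB 3 (π/k, ρ, w)`: a log-hyper-Liouville real COORDINATE next to a
π-scale, every `w` (a cell also in the hypothesis class of item 31077 `CoordLiouvilleSchanuel` when the triple is
ℚ-free). -/
theorem sb_three_piCoord {k : ℤ} (hk : k ≠ 0) {ρ : ℝ} (hρ : LogHyperLiouville ρ) (w : ℂ) :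
    SB 3 ![(Real.pi : ℂ) / k, (ρ : ℂ), w] := by
  have hz0 : (Real.pi : ℂ) / k ∈ adjoin ℚ (SFset ![(Real.pi : ℂ) / k, (ρ : ℂ), w] ∪ {I}) :=
    mem_adjoin_SFset_I' (Or.inl ⟨0, rfl⟩)
  have hz1 : (ρ : ℂ) ∈ adjoin ℚ (SFset ![(Real.pi : ℂ) / k, (ρ : ℂ), w] ∪ {I}) :=
    mem_adjoin_SFset_I' (Or.inl ⟨1, rfl⟩)
  have he0 : cexp ((Real.pi : ℂ) / k) ∈ adjoin ℚ (SFset ![(Real.pi : ℂ) / k, (ρ : ℂ), w] ∪ {I}) :=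
    mem_adjoin_SFset_I' (Or.inr ⟨0, rfl⟩)
  obtain ⟨hπ, he⟩ := pi_expPi_mem_of_scale hk hz0 he0
  exact sb_three_of_pi_expPi_mem hρ hz1 hπ he

/-- **RATIO-ELSEWHERE SHAPE (hypothesis-free).** `SB 3 (π/k, w, ρ·w)`, `w ≠ 0`: the log-hyper-Liouville ratio may
sit on the OTHER two coordinates. -/
theorem sb_three_piRatio {k : ℤ} (hk : k ≠ 0) {ρ : ℝ} (hρ : LogHyperLiouville ρ) {w : ℂ} (hw : w ≠ 0) :
    SB 3 ![(Real.pi : ℂ) / k, w, (ρ : ℂ) * w] := by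
  have hz0 : (Real.pi : ℂ) / k ∈ adjoin ℚ (SFset ![(Real.pi : ℂ) / k, w, (ρ : ℂ) * w] ∪ {I}) :=
    mem_adjoin_SFset_I' (Or.inl ⟨0, rfl⟩)
  have hz1 : w ∈ adjoin ℚ (SFset ![(Real.pi : ℂ) / k, w, (ρ : ℂ) * w] ∪ {I}) :=
    mem_adjoin_SFset_I' (Or.inl ⟨1, rfl⟩)
  have hz2 : (ρ : ℂ) * w ∈ adjoin ℚ (SFset ![(Real.pi : ℂ) / k, w, (ρ : ℂ) * w] ∪ {I}) :=
    mem_adjoin_SFset_I' (Or.inl ⟨2, rfl⟩)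
  have he0 : cexp ((Real.pi : ℂ) / k) ∈ adjoin ℚ (SFset ![(Real.pi : ℂ) / k, w, (ρ : ℂ) * w] ∪ {I}) :=
    mem_adjoin_SFset_I' (Or.inr ⟨0, rfl⟩)
  have hρmem : (ρ : ℂ) ∈ adjoin ℚ (SFset ![(Real.pi : ℂ) / k, w, (ρ : ℂ) * w] ∪ {I}) := by
    have hdiv := div_mem hz2 hz1
    rwa [mul_div_assoc, div_self hw, mul_one] at hdiv
  obtain ⟨hπ, he⟩ := pi_expPi_mem_of_scale hk hz0 he0
  exact sb_three_of_pi_expPi_mem hρ hρmem hπ he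

/-- **NON-VACUITY WITNESS.** The ratio `ℓ_T = Σ 2^{-(t_j)!}` (tree `RootDecomp1KRelLiouvilleCell.ellT`) is
log-hyper-Liouville (tree `logHyperLiouville_ellT`); it has NO exponential order 49 and is NOT hyper-Liouville (tree
`RootDecomp1KDarkLogSq05`: `not_liouvilleOrder49_ellT`, `not_hyperLiouville_ellT`, packaged in `piLine_member` below),
so the cell `(π/k, ℓ_T·π/k, w)` is decided here and by neither `hyperCell_pi_any` nor `ordCell_any`. -/
theorem sb_three_piLine_ellT {k : ℤ} (hk : k ≠ 0) (w : ℂ) :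
    SB 3 ![(Real.pi : ℂ) / k, (ellT : ℂ) * ((Real.pi : ℂ) / k), w] :=
  sb_three_piLine hk logHyperLiouville_ellT w

/-! ### §6a  MEMBER of the newly decided gap (typed, hypothesis-free)

`ρ⋆ := ℓ_T` lies in `LogHyperLiouville ∖ (HyperLiouville ∪ LiouvilleOrder 49)` — tree facts
`logHyperLiouville_ellT` (RelLiouvilleCell05), `not_hyperLiouville_ellT`, `not_liouvilleOrder49_ellT` (DarkLogSq05) —
so on the π-lines the cell `(π/k, ℓ_T·π/k, w)` is decided HERE, by NEITHER `hyperCell_pi_any` (hyper ρ, mod Cor. 5.2)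
NOR `ordCell_any` (ρ of exponential order 49, mod NW96 Thm 1). -/

/-- **THE MEMBER `ℓ_T` with its three typed certificates and the decided instances (all hypothesis-free).** -/
theorem piLine_member :
    LogHyperLiouville ellT ∧ ¬ HyperLiouville ellT ∧ ¬ LiouvilleOrder 49 ellT ∧
      ∀ k : ℤ, k ≠ 0 → ∀ w : ℂ, SB 3 ![(Real.pi : ℂ) / k, (ellT : ℂ) * ((Real.pi : ℂ) / k), w] :=
  ⟨logHyperLiouville_ellT, not_hyperLiouville_ellT, not_liouvilleOrder49_ellT,
    fun _ hk w => sb_three_piLine_ellT hk w⟩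

/-! ### §6b  The tree's π-cells with their `h52` binder REMOVED

`RootDecomp1KHyper.HyperCell.hyperCell_pi_any (h52) (hρ : HyperLiouville ρ) (w)` and `hyperCell_pi_gamma_any` take the
REGISTERED Cor. 5.2 as a hypothesis.  Their conclusions hold hypothesis-free (hyper-Liouville ⇒ exponential order 1 ⇒
log-hyper-Liouville, tree `LiouvilleOrder.of_hyperLiouville` + `logHyperLiouville_of_liouvilleOrder`). -/

/-- A hyper-Liouville real is log-hyper-Liouville. -/
private theorem logHyperLiouville_of_hyperLiouville {ρ : ℝ} (hρ : HyperLiouville ρ) : LogHyperLiouville ρ :=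
  logHyperLiouville_of_liouvilleOrder le_rfl (LiouvilleOrder.of_hyperLiouville hρ 1)

/-- **`hyperCell_pi_any` WITHOUT `h52`** — the tree theorem's conclusion, hypothesis-free. -/
theorem hyperCell_pi_any_free {ρ : ℝ} (hρ : HyperLiouville ρ) (w : ℂ) :
    HyperLinLiouville ![(Real.pi : ℂ), (ρ : ℂ) * Real.pi, w] ∧
      SB 3 ![(Real.pi : ℂ), (ρ : ℂ) * Real.pi, w] := by
  refine ⟨?_, sb_three_piLine_one (logHyperLiouville_of_hyperLiouville hρ) w⟩
  refine hyperLinLiouville_of_prefix (k := 2) (by omega) ?_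
  have h2 : (fun i : Fin 2 => (![(Real.pi : ℂ), (ρ : ℂ) * Real.pi, w] : Fin 3 → ℂ)
      (Fin.castLE (show 2 ≤ 3 by omega) i)) = ![(Real.pi : ℂ), (ρ : ℂ) * Real.pi] := by
    funext i; fin_cases i <;> rfl
  rw [h2]; exact hyperLinLiouville_of_hyperLiouville_ratio hρ _

/-- **`hyperCell_pi_gamma_any` WITHOUT `h52`** — the tree theorem's conclusion, hypothesis-free. -/
theorem hyperCell_pi_gamma_any_free {ρ : ℝ} (hρ : HyperLiouville ρ) (w : ℂ) :
    HyperLinLiouville ![(Real.pi : ℂ), (ρ : ℂ) * Real.pi, (Real.Gamma (1 / 4) : ℂ), w] ∧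
      SB 4 ![(Real.pi : ℂ), (ρ : ℂ) * Real.pi, (Real.Gamma (1 / 4) : ℂ), w] := by
  refine ⟨?_, ?_⟩
  · refine hyperLinLiouville_of_prefix (k := 2) (by omega) ?_
    have h2 : (fun i : Fin 2 =>
        (![(Real.pi : ℂ), (ρ : ℂ) * Real.pi, (Real.Gamma (1 / 4) : ℂ), w] : Fin 4 → ℂ)
        (Fin.castLE (show 2 ≤ 4 by omega) i)) = ![(Real.pi : ℂ), (ρ : ℂ) * Real.pi] := by
      funext i; fin_cases i <;> rfl
    rw [h2]; exact hyperLinLiouville_of_hyperLiouville_ratio hρ _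
  · have h := sb_four_piGammaLine (k := 1) one_ne_zero (logHyperLiouville_of_hyperLiouville hρ) w
    simpa using h

/-! ## §7  Certificate: the `n = 3` residual of record shrinks on the scale family `(ℤ ∖ 0)⁻¹ π` -/

/-- **RESIDUAL SHRINK at the π-scales (hypothesis-free).**  Schanuel's bound at every line cell
`(π/k, ρ·π/k, w)` with a real Liouville ratio follows from the cells whose ratio is NOT log-hyper-Liouville
(the tree's residual of record `RootDecomp1KGeneric.sb_three_lineCell_of_lowOrderResidual` excepted, mod NW96
Thm 1, the ratios of NO exponential order 49 — a larger exceptional class, see the next lemma). -/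
theorem sb_three_piLine_of_logFloorResidual
    (hres : ∀ (k : ℤ) (ρ : ℝ) (w : ℂ), k ≠ 0 → Liouville ρ → ¬ LogHyperLiouville ρ →
      SB 3 ![(Real.pi : ℂ) / k, (ρ : ℂ) * ((Real.pi : ℂ) / k), w])
    {k : ℤ} (hk : k ≠ 0) {ρ : ℝ} (hρ : Liouville ρ) (w : ℂ) :
    SB 3 ![(Real.pi : ℂ) / k, (ρ : ℂ) * ((Real.pi : ℂ) / k), w] := by
  by_cases hlog : LogHyperLiouville ρ
  · exact sb_three_piLine hk hlog w
  · exact hres k ρ w hk hρ hlog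

/-- **ITEM 33364 (`FiniteOrderLiouvilleSchanuel`), binders verbatim at `n = 3`, on the class
«`z = (π/k, ρ·z₀, w)`, `ρ` real log-hyper-Liouville» — hypothesis-free** (the Liouville / finite-order binders
are not used: the decided region is larger than the item's hypothesis class on these lines). -/
theorem item33364_three_piLineClass (z : Fin 3 → ℂ) (_hz : LinearIndependent ℚ z)
    (_hL : ∀ ω : ℕ, ∃ h : Fin 3 → ℤ, h ≠ 0 ∧ ‖∑ i, (h i : ℂ) * z i‖ < 1 / (1 + ∑ i, (|h i| : ℝ)) ^ ω)
    (_hH : ¬ ∀ m : ℕ, ∃ h : Fin 3 → ℤ, h ≠ 0 ∧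
      ‖∑ i, (h i : ℂ) * z i‖ < Real.exp (-((1 + ∑ i, (|h i| : ℝ)) ^ m)))
    (hcls : ∃ (k : ℤ) (ρ : ℝ), k ≠ 0 ∧ LogHyperLiouville ρ ∧ z 0 = (Real.pi : ℂ) / k ∧ z 1 = (ρ : ℂ) * z 0) :
    ((3 : ℕ) : Cardinal) ≤ Algebra.trdeg ℚ
      ↥(IntermediateField.adjoin ℚ (Set.range z ∪ Set.range (Complex.exp ∘ z))) := by
  obtain ⟨k, ρ, hk, hρ, h0, h1⟩ := hcls
  have ez : z = ![(Real.pi : ℂ) / k, (ρ : ℂ) * ((Real.pi : ℂ) / k), z 2] := by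
    funext i; fin_cases i
    · exact h0
    · simpa [h0] using h1
    · rfl
  rw [ez]; exact sb_three_piLine hk hρ (z 2)

/-- **ITEM 33363 (`HyperLiouvilleSchanuel`), binders verbatim at `n = 3`, on the same class — hypothesis-free.** -/
theorem item33363_three_piLineClass (z : Fin 3 → ℂ) (_hz : LinearIndependent ℚ z)
    (_hH : ∀ m : ℕ, ∃ h : Fin 3 → ℤ, h ≠ 0 ∧
      ‖∑ i, (h i : ℂ) * z i‖ < Real.exp (-((1 + ∑ i, (|h i| : ℝ)) ^ m)))
    (hcls : ∃ (k : ℤ) (ρ : ℝ), k ≠ 0 ∧ LogHyperLiouville ρ ∧ z 0 = (Real.pi : ℂ) / k ∧ z 1 = (ρ : ℂ) * z 0) :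
    ((3 : ℕ) : Cardinal) ≤ Algebra.trdeg ℚ
      ↥(IntermediateField.adjoin ℚ (Set.range z ∪ Set.range (Complex.exp ∘ z))) := by
  obtain ⟨k, ρ, hk, hρ, h0, h1⟩ := hcls
  have ez : z = ![(Real.pi : ℂ) / k, (ρ : ℂ) * ((Real.pi : ℂ) / k), z 2] := by
    funext i; fin_cases i
    · exact h0
    · simpa [h0] using h1
    · rfl
  rw [ez]; exact sb_three_piLine hk hρ (z 2)

end Summit.Schanuel.Schanuel.Theorems.RootDecomp1KPiScale

end
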